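import Literature.Analysis.FluidPDE.LerayHopfGalileanTorusWeak
import Literature.Analysis.FluidPDE.LerayHopfGalileanTorusEnergy
import Literature.Analysis.FluidPDE.LerayHopfGalileanTorusContinuity
import Literature.Analysis.FluidPDE.LerayHopfSliceZeroTorus
import HarnessLib

/-!
# Galilean covariance of Leray–Hopf weak solutions on the flat torus

Analysis/FluidPDE support file (all proved).  Let `u` be a Leray–Hopf weak solution of the Navier–Stokes
equations on `T^d × [0, T)` (`Torus.IsLerayHopfOn T ν (fun _ => f) u₀ u`, Leray 1934 §III, Galdi 2000 Def. 2.1)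
driven by a steady smooth force `f` of zero mean, and let `V ∈ ℝ^d` be a constant velocity.  In the frame moving
with velocity `V` (`y = x − tV`) the velocity, datum and force are

  `v t y := u t (y + [tV]) − V`,   `v₀ := u₀ − V`,   `g t y := f (y + [tV])`,   `[tV] := proj (t • V)`,

and `v` is again a Leray–Hopf weak solution on `T^d × [0, T)` with viscosity `ν`, force `g` and datum `v₀`
(`Torus.IsLerayHopfOn.galilean_unboost`), provided the time-zero slice has been normalised to `u 0 = u₀` (harmless:
`Torus.IsLerayHopfOn.update_zero`); the global version is `Torus.IsGlobalLerayHopf.galilean_unboost`, and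
`Torus.IsGlobalLerayHopf.galilean_unboost_update` packages the normalisation.  The fields are assembled from
`LerayHopfGalileanTorusWeak` (weak formulation), `LerayHopfGalileanTorusEnergy` (energy class and energy
inequalities: kinetic energy shifts by a constant by momentum conservation, dissipation and power are frame
independent) and `LerayHopfGalileanTorusContinuity` (weak continuity, strong trace: `L²`-continuity of translations).

This is the weak-solution form of the Galilean invariance of the Navier–Stokes equations (U. Frisch,
*Turbulence* (1995) §2.2; for classical solutions on `ℝ × T³` see the summit-side `Galilean.Covariance`).  It is
the device by which drifting families on the periodic box are compared with zero-momentum families (Doering–Foias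
2002 §2: the mean flow `∫ u` is conserved under a zero-mean force and can be removed by a change of frame — at the
price of making a steady force time dependent unless the force is invariant along the drift).
-/

noncomputable section

open MeasureTheory Set Filter Topology Function
open scoped InnerProductSpace RealInnerProductSpace ENNReal NNReal

namespace Literature.Analysis.FluidPDE.Torus

open Literature.Analysis.FunctionSpaces Literature.Analysis.FunctionSpaces.Torus

variable {d : Type*} [Fintype d] [DecidableEq d]
variable {T ν : ℝ} {f : UnitAddTorus d → EuclideanSpace ℝ d} {u₀ : UnitAddTorus d → EuclideanSpace ℝ d}
  {u : ℝ → UnitAddTorus d → EuclideanSpace ℝ d}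

/-- **Galilean covariance of Leray–Hopf solutions on `T^d × [0, T)`** (steady smooth zero-mean force, time-zero
slice normalised to the datum): `v t y = u t (y + [tV]) − V` is a Leray–Hopf solution driven by the swept force
`f (· + [tV])` from the datum `u₀ − V`. [folklore] -/
theorem IsLerayHopfOn.galilean_unboost (h : IsLerayHopfOn T ν (fun _ => f) u₀ u) (hT : 0 < T)
    (hf : IsSmooth f) (hf0 : HasZeroMean f) (h0 : u 0 = u₀) (V : EuclideanSpace ℝ d) :
    IsLerayHopfOn T ν (fun t y => f (y + proj (t • V))) (fun y => u₀ y - V)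
      (fun t y => u t (y + proj (t • V)) - V) := by
  have hu₀ : MemLp u₀ 2 volume := h0 ▸ h.memLp 0 ⟨le_rfl, hT.le⟩
  exact
    { weak := h.weak.galilean_unboost hf (hu₀.integrable one_le_two) V
      energy_bound := h.galilean_energy_bound V
      memLp := h.galilean_memLp V
      memL2Sobolev := h.galilean_memL2Sobolev V
      energy_ineq_zero := h.galilean_energy_ineq_zero hT hf hf0 h0 V
      energy_ineq_ae := h.galilean_energy_ineq_ae hT hf hf0 V
      weak_continuous := h.galilean_weak_continuous hT hu₀ V
      strong_initial := h.galilean_strong_initial hu₀ V }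

/-- **Galilean covariance of global Leray–Hopf solutions on `T^d`** (steady smooth zero-mean force, `u 0 = u₀`).
[folklore] -/
theorem IsGlobalLerayHopf.galilean_unboost (h : IsGlobalLerayHopf ν (fun _ => f) u₀ u)
    (hf : IsSmooth f) (hf0 : HasZeroMean f) (h0 : u 0 = u₀) (V : EuclideanSpace ℝ d) :
    IsGlobalLerayHopf ν (fun t y => f (y + proj (t • V))) (fun y => u₀ y - V)
      (fun t y => u t (y + proj (t • V)) - V) :=
  fun T hT => (h T hT).galilean_unboost hT hf hf0 h0 V

/-- **Galilean covariance of global Leray–Hopf solutions, with the normalisation built in**: for an `L²` datum,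
first replace the time-zero slice by the datum (`IsGlobalLerayHopf.update_zero`, invisible to every clause at
positive times), then boost. [folklore] -/
theorem IsGlobalLerayHopf.galilean_unboost_update (h : IsGlobalLerayHopf ν (fun _ => f) u₀ u)
    (hf : IsSmooth f) (hf0 : HasZeroMean f) (hu₀ : MemLp u₀ 2 volume) (V : EuclideanSpace ℝ d) :
    IsGlobalLerayHopf ν (fun t y => f (y + proj (t • V))) (fun y => u₀ y - V)
      (fun t y => update u 0 u₀ t (y + proj (t • V)) - V) :=
  (h.update_zero hu₀).galilean_unboost hf hf0 (update_self 0 u₀ u) V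

/-- **A measurable datum of a Leray–Hopf solution on the torus is square integrable**: `u₀ = u(t) − (u(t) − u₀)`
with `u(t) ∈ L²` and `‖u(t) − u₀‖₂ < 1` for small `t > 0` (torus twin of the whole-space
`IsLerayHopfOn.memLp_two_datum`; Escauriaza–Seregin–Šverák 2003, (1.7)). [folklore] -/
theorem IsLerayHopfOn.memLp_two_datum {F : ℝ → UnitAddTorus d → EuclideanSpace ℝ d} (h : IsLerayHopfOn T ν F u₀ u)
    (hT : 0 < T) (hm : AEStronglyMeasurable u₀ volume) : MemLp u₀ 2 volume := by
  have hev : ∀ᶠ t in 𝓝[>] (0 : ℝ), eLpNorm (u t - u₀) 2 volume < 1 :=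
    h.strong_initial (Iio_mem_nhds zero_lt_one)
  obtain ⟨t, ht, htT⟩ := (hev.and (Ioo_mem_nhdsGT hT)).exists
  have hut : MemLp (u t) 2 volume := h.memLp t (Ioo_subset_Icc_self htT)
  have hdiff : MemLp (u t - u₀) 2 volume := ⟨hut.1.sub hm, ht.trans ENNReal.one_lt_top⟩
  have := hut.sub hdiff
  simpa using this

/-- A measurable datum of a global Leray–Hopf solution on the torus is square integrable. [folklore] -/
theorem IsGlobalLerayHopf.memLp_two_datum {F : ℝ → UnitAddTorus d → EuclideanSpace ℝ d}
    (h : IsGlobalLerayHopf ν F u₀ u) (hm : AEStronglyMeasurable u₀ volume) : MemLp u₀ 2 volume :=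
  (h 1 one_pos).memLp_two_datum one_pos hm

end Literature.Analysis.FluidPDE.Torus
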